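import Summits.QuantumAdvantage.QuantumAdvantage.Theses.CubicForrelation
import Literature.Computability.QuantumComplexity.CubicForrelationEstimatorAnalysis

/-!
# `CubicForrelationInPrBPP` holds — crux `stmt-QuantumAdvantage-2204` (route `CubicForrelation`, rank 4)

The route decl `Summit.QuantumAdvantage.QuantumAdvantage.Theses.CubicForrelation.CubicForrelationInPrBPP`
says: cubic explicit 2-fold Forrelation `CF₂` (codes of `k = 2`-fold Forrelation instances with `n`
even and both `B₂`-circuits computing Boolean functions of `𝔽₂`-degree `≤ 3`; YES `Φ ≥ 3/5`,
NO `|Φ| ≤ 1/100`) lies in textbook promise-`BPP` (`PromiseBPP'`). By `rfl`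
(`cubicKForrelationProblem_two_eq`) this is the statement `cubicKForrelationProblem 2 ∈ PromiseBPP'`,
which is the landed Literature theorem
`Literature.Computability.QuantumComplexity.CubicDequant.cubicKForrelationProblem_two_mem_PromiseBPP'`
(`CubicForrelationEstimatorAnalysis.lean`; machine `CubicForrelationEstimatorMachine.lean`): the
Φ²-estimator — derivative/Pauli expansion `2^{3n} Φ² = Σ_{h,u} T_f(h,u) T_g(u,h)`
(`DerivativeWalsh.two_pow_mul_forrelation_sq`), quadratic derivatives of cubics
(`CubicDequant.Df_quadratic`) so every table entry is an exact quadratic Gauss sum and the one-sided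
proposal `∝ T_f(h,·)²` is exactly samplable (Dickson coset, `QuadraticFourierSampler`), ratio statistic
with `Σ X = 4ⁿ Φ²`, `Σ X² ≤ 4ⁿ` (`sum_Xst_eq`, `sum_Xst_sq_le`), Chebyshev over `N = 128` coin blocks at
threshold `9/50`, and the idle-wire guard `n ≤ |x| + 1` on YES instances (`guard_of_isYes`) — with its
`Classes.P` witness via `PromiseProblem.mem_PromiseBPP'_of_fp_decider`.

Line: the three triaged crux lines (`pauli-ct-overlap` ≈ `pauli-fidelity-sampling` ≈
`polarised-derivative-sampling`) are the same lever as the landed proof; the built line is this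
one-term composition (zero stubs). Sources: [AaronsonAmbainis2018] §6 (the `k`-fold Forrelation problem
and why the lever stops at `k = 3`); [BravyiGossetGrierSchaeffer2021] Thm 1 / §1 (graph-based, degree-2
rung); quadratic Gauss sums [BravyiGosset2016] App. A.
-/

set_option linter.dupNamespace false -- D-0017: single-problem summit ⇒ `QuantumAdvantage.QuantumAdvantage` by design

namespace Summit.QuantumAdvantage.QuantumAdvantage.Theorems

open Literature.Computability.QuantumComplexity

/-- **Crux `CubicForrelationInPrBPP` (stmt-QuantumAdvantage-2204) holds**: cubic 2-fold Forrelation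
(`k = 2`, `n` even, both phase functions of algebraic degree `≤ 3`; YES `Φ ≥ 3/5`, NO `|Φ| ≤ 1/100`)
is in `PromiseBPP'`. The route decl unfolds by `rfl` to `cubicKForrelationProblem 2 ∈ PromiseBPP'`,
the landed theorem `CubicDequant.cubicKForrelationProblem_two_mem_PromiseBPP'` (Φ²-estimator machine:
exact quadratic Fourier sampling of the derivative Walsh tables, Chebyshev over 128 coin blocks,
idle-wire guard). -/
theorem CubicForrelationInPrBPP_proof :
    Summit.QuantumAdvantage.QuantumAdvantage.Theses.CubicForrelation.CubicForrelationInPrBPP :=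
  CubicDequant.cubicKForrelationProblem_two_mem_PromiseBPP'

end Summit.QuantumAdvantage.QuantumAdvantage.Theorems
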